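import Literature.MathematicalPhysics.QuantumFieldTheory.Balaban1983to89.B9Eq3115KnitLetterYRowCloseness
import Literature.MathematicalPhysics.QuantumFieldTheory.Balaban1983to89.B7Prop7LinearKernelBackgroundModulus

/-!
# `Balaban1983to89.B9Eq380QknitVariationY` — T. Bałaban, *Propagators for lattice gauge theories in a background field*, Commun. Math. Phys. **99** (1985)
# 389–434 [Balaban1985BackgroundPropagators] (3.78)–(3.81) p. 406, with *Averaging operations for lattice gauge theories*, CMP **98** (1985) [Balaban1985Averaging]
# Props. 5–7 pp. 42–43: ★★★ **(3.80)–(3.81) FOR THE KNIT AVERAGING LETTER `Q(U) = QknitY` ON THE CLASS (3.35), IN ROW FORM** —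
# `‖(Q(e^{iηa}·U)Λ)(ι) − (Q(U)Λ)(ι)‖ ≤ (9∕(2ϱ′))·α₁·Σ_f boxK ι f·‖Λ(f)‖` at every index bond `ι` (level `j`), for every member background `U` of
# `(bg9KP … G i).Reg335 c₀ α₀` (`G ≤ U(N)`), every complex perturbation `a` with `Lʲη·|a| ≤ α₁` on the two end blocks of `ι` (print's (3.37)
# «|A′| < α₁(Lʲη)⁻¹ on Bʲ(Λ_j)»), `3α₁ ≤ ϱ′`, and x-free numerics — by RETRACTION to the double block (this lineage's `QknitY_apply_retract` road) and file 1's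
# kernel modulus `B7Prop7LinearKernelBackgroundModulus.norm_linCovIter_sub_base_le_sum` at the retracted base

statement-level skeleton of published theorems with citation tags; proofs where landed; nothing here is a claim about the Yang–Mills mass gap

PDFs held: `paper:balaban1985-cmp99-background-propagators` (p. 406 read this seat, text layer `p0018`), `paper:balaban1985-cmp98-averaging` (pp. 39–43, `p0023`–`p0027`).

CITATION HEADER (lean-in-tree rule).  Cell `pub-ymgap` (YM Track A, D-0062), node N06 = [Balaban1985BackgroundPropagators], seat `pub-ymgap-dag-n06-l` (gen 39; bundle F7
rows 20–21; K1⁹ `stmt-QuantumFields-27364` SUPPORTS lane), programme «P-Q80-knit» file 2 (dag-lead WORDS 490∕498: the K2-G variation laws `hQ80 ∕ hQL280` at the knit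
pair are this seat's).  REUSED BY NAME, nothing restated: file 1 `B7Prop7LinearKernelBackgroundModulus.norm_linCovIter_sub_base_le_sum` (the ℤ^{d+1} brick); this
lineage's `B9Eq3115KnitLetterYOnto.retrY ∕ agreeOn_liftCfg_retrY ∕ retrY_mem ∕ QknitY_apply_retract`, `B9Eq3115KnitLetterYRowCloseness.boxK ∕ boxK_nonneg ∕
sum_boxK_mul_eq`, `B9Eq3124HZKnitPairReg335Y.pdev_retract_bond_lt`, `B9Eq3115KnitLetterYFarFace.iterBlockOf_transl_zero ∕ blk_of_inBox_bond`,
`B9Eq3115KnitLetterY.QknitY ∕ QknitY_apply ∕ zSrc ∕ transl_zero_zSrc ∕ lvl_le'`, `B7Prop4LinCovIterClosed.linCovIterC_eq_linCovIter`,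
`B7Prop4LinCovIterClosedLaws.linCovIterC_congr`; r04∕p06 `B7Prop7Levels.level_loops_lt_one`, `B7Prop5CplxLevels.avgIter_cplx_eq ∕ epsCplx ∕ tauCplx`,
`B7Prop5Cplx.thetaCplx`, `B7Prop7Ins.smallness7_mono`; b07 `B7Prop5Flat.insCfg ∕ restr ∕ agreeOn_insCfg_restr ∕ agreeOn_expCfg ∕ bondsIn`, `B7Prop2Explicit.avgClosed_unitaryUnits`;
J-A `B9B8CarrierDictionary.liftCfg`, t2s-1 `B9B8KnitBondTransfer.liftBd`; r06 `B9Eq39Adjoint.fluct`; n06-c `B9C2FormBoxRegimeY.Kpl` (the member field `e^{iηa}·U` is written `fun μ x => fluct η a μ x * U μ x` = def-Y's `mulY i (fluct η a) U = decY (.prod U a)` by `rfl`),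
`B9BackgroundsKLevelV1P.bg9KP ∕ mem_of_reg335P`.

THE PRINT.  [B9] p. 406: *«Finally we consider the averaging operator Q(U). It coincides with Q_j(U) on B^j(Λ_j), and Q_j(U′U) is given by the product (3.78) …
By Proposition 6 [5] the averages Ũ′^n … are analytic functions of A on configurations satisfying the first inequality in (3.37), i.e. |A| < α₁(Lʲη)⁻¹ on
B^j(Λ_j). … Q(exp(iB)V) = Q(V) + F₂(B), |F₂(B)B′| ≦ O(1) sup|B| Q″|B′| (3.79) … Q_j(U′U) = Q_j(U) + F_{2,j}(A), (3.80) … |F_{2,j}(A)A′| ≦ … ≦ O(1)α₁Q″_j|A′|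
on Λ_j, (3.81) for Mα₀, α₁ sufficiently small and with a constant O(1) depending on d and L only.»*  (`Q″_j` = [5] (141): the `L^{−jd}`-normalised two-block sum —
the tree's `boxK`.)

THE ROAD.  For an index bond `ι` of level `j` (box `[Lʲz_ι, Lʲz_ι + (Lʲ−1)𝟙 + Lʲe_κ]`): (i) `(Q(U)Λ)(ι) = L^{−j}·(LʲQ_j(Û_ι)Λ♯)(z_ι, κ)` at the retraction `Û_ι` of the
lift `U♯`, which is `U(N)`-valued and `α₀′L^{−2j}`-regular on (3.35) (`QknitY_apply_retract`); (ii) the lift of the perturbed member field is `(e^{iηa}U)♯ = e^{a♯}·U♯`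
with `a♯(s) = iη·a(s♭)` (`liftCfg_mulY_fluct`), and by locality of the gated composite (`linCovIterC_congr`) one may replace `U♯ ↦ Û_ι` and `a♯ ↦ a♭` (the restriction of
`a♯` to the box bonds, zero elsewhere) — so `(Q(e^{iηa}U)Λ)(ι) = L^{−j}·(LʲQ_j(e^{a♭}Û_ι)Λ♯)(z_ι, κ)`, the gate being open at the complex background `e^{a♭}Û_ι` by r04's
`level_loops_lt_one` (`linCovIterC_eq_linCovIter`); (iii) file 1 at the base `Û_ι`, scale `k := j`, perturbation `a♭` (`sup‖a♭‖ ≤ α₁∕Lʲ` from the end-block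
hypothesis) bounds the difference of the two un-normalised composites by `(3Lʲ∕ϱ′)·(α₁∕Lʲ)·(1 + ϑ)·Lʲ·L^{−j(d+1)}·Σ_{s ⊂ box}‖Λ♯(s)‖`; (iv) the fibrewise reading
`Σ_{s ⊂ box}‖Λ♯(s)‖ = (Lʲ)^{d+1}·Σ_f boxK ι f‖Λ f‖` (`sum_boxK_mul_eq`) and `1 + ϑ ≤ 3∕2` (from the displayed (145) numerics) give the display.

WHAT IS PROVED (sorry-free; 0 `def`; no `Prop` placeholder).
* §1 dictionary ∕ numerics: `liftCfg_mulY_fluct` (`(e^{iηa}U)♯ = e^{a♯}·U♯`), private `rescale_mul_inv` (`Lʲ·(ϱ·L^{−j}) = ϱ`), `thetaCplx_rescale` (the (147) coefficient at the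
  rescaled radius is level-free), `thetaCplx_le_half` (`ϑ ≤ 1∕2` under the displayed (145) numerics), `end_block_of_mem_bondsIn` (a box bond's source lies in an end
  block of `ι`).
* §2 ★★ `QknitY_mulY_apply_retract` — `(Q(e^{iηa}U)Λ)(ι)` THROUGH THE RETRACTION, UNGATED, at the complex background `e^{a♭}·Û_ι` (steps (ii)).
* §3 ★★★ `norm_QknitY_mulY_sub_apply_le` — **(3.80)–(3.81) FOR THE KNIT LETTER, ROW FORM** (statement in the title), hypotheses: `(bg9KP … G i).Reg335 c₀ α₀ U`
  (`G ≤ U(N)`, `c₀ ≤ 10`, `0 ≤ Mα₀`), the end-block smallness `Lʲη·‖a_μ(x)‖ ≤ α₁` (`0 ≤ α₁`, `3α₁ ≤ ϱ′`), and the x-free numerics `0 < α₀′`, `C₀α₀′ ≤ 1∕3`,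
  `8α₀′ ≤ c₂′`, `K_pl(Mα₀)·L⁴ < α₀′` (this lineage's (3.35) ⇒ (52) bridge), r04∕p06's Prop-7∕Prop-5 window at the radii `ϱ′` (background) ∕ `ϱ` (field) IN COARSE UNITS
  (`Lʲρ′ = ϱ′`: level-free): `hsmall′ hc₃′ hϱ′1 hE hdX hsmall hc₃`.
HONEST SCOPE ∕ DECLARED READINGS.  (i) A composition BY NAME of landed theorems (file 1's Cauchy estimate, the retraction road, r04∕p06's regime data); crude constant
`9∕(2ϱ′)` for print's `O(1)` (the Cauchy route; `ϱ′` is any admissible radius of the displayed window, e.g. `ϱ′ = 1∕(409600(d+2)²)`); (ii) the perturbation size is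
hypothesised on the two END BLOCKS of `ι` in print's own currency `Lʲη|A′| ≤ α₁` — its discharge from r06's nested class `Cplx337` (levels `≥ j − 1` there, one factor `L`)
is the consumer's ∕ file 3's; (iii) only `Q`; the adjoint letter's `F*_{2,j}` («not the adjoint of F_{2,j}» for complex `a`) is file 3's business through the transposed
kernel.  Count-neutral; N06 NOT discharged; K1⁹ NOT closed; nothing continuum ∕ ℝ⁴ ∕ OS ∕ mass gap ∕ Clay — the Yang–Mills mass gap is NOT proved here.  NEW file; nothing
landed is modified.  No `sorry`, no `axiom`, no `def`, no `instance`, no `notation`.  Net new unproved facts: 0.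
-/

noncomputable section

namespace Literature.MathematicalPhysics.QuantumFieldTheory.Balaban1983to89.B9Eq380QknitVariationY

open scoped BigOperators
open NormedSpace
open B7Prop1Explicit renaming Site → LSite
open B7Prop1Explicit (e e_apply boxVec U1 Wcx)
open B7Prop1Local (InBox AgreeOn loK bondHiK)
open B7Prop5Flat (BondIn bondsIn mem_bondsIn restr agreeOn_insCfg_restr agreeOn_expCfg)
open B7Prop3Flat (insCfg expCfg c3)
open B7Prop2Explicit (pdev avgIter avgClosed_unitaryUnits unitaryUnits unitaryUnits_le_U1 C0 c2')
open B7Prop4GeneralLevels (linCovIter)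
open B7Prop4LinCovIterClosed (linCovIterC linCovIterC_eq_linCovIter)
open B7Prop4LinCovIterClosedLaws (linCovIterC_congr)
open B7Prop7Levels (level_loops_lt_one)
open B7Prop7Ins (smallness7_mono)
open B7Prop5CplxLevels (epsCplx tauCplx avgIter_cplx_eq)
open B7Prop5Cplx (thetaCplx thetaCplx_nonneg)
open B7Prop7LinearKernelBackgroundModulus (norm_linCovIter_sub_base_le_sum)
open B10Eq27TorusAxialLog (transl transl_apply transl_add_e)
open B4Reflection242 (blk)
open B5Eq118OneStroke (iterBlockOf)
open B6GlobalChartV1 (PV)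
open B6KLevelCensusIndexV1 (KIdx kGeo)
open B9B8CarrierDictionary (liftCfg liftCfg_apply)
open B9B8KnitBondTransfer (liftBd liftBd_apply)
open B9Eq3115KnitLetterY (zSrc transl_zero_zSrc QknitY QknitY_apply lvl_le')
open B9Eq3115KnitLetterYFarFace (iterBlockOf_transl_zero blk_of_inBox_bond)
open B9Eq3115KnitLetterYOnto (retrY agreeOn_liftCfg_retrY retrY_mem QknitY_apply_retract)
open B9Eq3115KnitLetterYRowCloseness (boxK boxK_nonneg sum_boxK_mul_eq)
open B9Eq3124HZKnitPairReg335Y (pdev_retract_bond_lt)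
open B9C2FormBoxRegimeY (Kpl)
open B9BackgroundsKLevelV1P (bg9KP mem_of_reg335P)
open B9Eq39Adjoint (fluct)
open Beta.TransportVertices (holonomy_cons holonomy_nil)
open Node00

variable {d ℓ : ℕ} {hd : 1 ≤ d + 1} {hL : Odd (ℓ + 1) ∧ 1 < ℓ + 1} {b₀ b₁ : ℝ}

/-! ## §1 Dictionary and numerics -/

section Dict

variable {𝔸 : Type} [NormedRing 𝔸] [NormedAlgebra ℂ 𝔸] [CompleteSpace 𝔸]
variable (i : KIdx d ℓ hd hL b₀ b₁)

/-- ★ **THE LIFT OF THE PERTURBED MEMBER FIELD**: `(e^{iηa}·U)♯ = e^{a♯}·U♯` with `a♯(s) = iη·a(s♭)` — the periodic lift (J-A's `liftCfg`) of r06's `fluct η a`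
times `U` is b07's exponential configuration of the lifted exponent times the lift of `U`. [cite: Balaban1985BackgroundPropagators, p.396 (before (3.37)), (3.78) p.406, dictionary] -/
theorem liftCfg_mulY_fluct (η : ℝ) (a : Fin (d + 1) → Site (PV d ℓ i.m i.K hd hL) 0 → 𝔸) (U : CfgY 𝔸 i) :
    liftCfg (P := PV d ℓ i.m i.K hd hL) (fun μ x => fluct η a μ x * U μ x) =
      expCfg (fun z μ => ((Complex.I * η : ℂ)) • a μ (transl (0 : Site (PV d ℓ i.m i.K hd hL) 0) z)) * liftCfg U := by
  funext z μ
  refine Units.ext ?_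
  rw [Pi.mul_apply, Pi.mul_apply, Units.val_mul, liftCfg_apply, liftCfg_apply, Units.val_mul]
  simp [fluct, expCfg]

omit i in
/-- `Lʲ·(ϱ·L^{−j}) = ϱ` (the coarse-unit radius is level-free). [folklore] -/
private theorem rescale_mul_inv (j : ℕ) (ϱ : ℝ) : (((ℓ + 1 : ℕ) : ℝ)) ^ j * (ϱ * ((((ℓ + 1 : ℕ) : ℝ)) ^ j)⁻¹) = ϱ := by
  have hne : (((ℓ + 1 : ℕ) : ℝ)) ^ j ≠ 0 := by positivity
  rw [mul_comm ϱ, ← mul_assoc, mul_inv_cancel₀ hne, one_mul]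

omit i in
/-- the (147) coefficient `ϑ` of p06 at the rescaled radius `ϱ′·L^{−j}` and `k = j` equals its value at `k = j = 0` and radius `ϱ′` (level-free).
[cite: Balaban1985Averaging, (146)–(147) p.40, Proposition 7 p.43, bookkeeping] -/
theorem thetaCplx_rescale (α₀' ϱ' : ℝ) (j : ℕ) :
    thetaCplx (d + 1) (ℓ + 1) α₀' j (ϱ' * ((((ℓ + 1 : ℕ) : ℝ)) ^ j)⁻¹) = thetaCplx (d + 1) (ℓ + 1) α₀' 0 ϱ' := by
  have hne : (((ℓ + 1 : ℕ) : ℝ)) ^ j ≠ 0 := by positivity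
  unfold thetaCplx epsCplx tauCplx
  rw [rescale_mul_inv, mul_inv_cancel₀ hne, pow_zero, mul_inv_cancel₀ one_ne_zero, one_mul]

omit i in
/-- the same for the two (145)-numerics `ε`, `τ`. [cite: Balaban1985Averaging, (145) p.40, Proposition 7 p.43, bookkeeping] -/
theorem epsCplx_tauCplx_rescale (α₀' ϱ' : ℝ) (j : ℕ) :
    epsCplx (d + 1) (ℓ + 1) (ϱ' * ((((ℓ + 1 : ℕ) : ℝ)) ^ j)⁻¹) j = epsCplx (d + 1) (ℓ + 1) ϱ' 0 ∧
      tauCplx (d + 1) (ℓ + 1) α₀' j (ϱ' * ((((ℓ + 1 : ℕ) : ℝ)) ^ j)⁻¹) j = tauCplx (d + 1) (ℓ + 1) α₀' 0 ϱ' 0 := by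
  have hne : (((ℓ + 1 : ℕ) : ℝ)) ^ j ≠ 0 := by positivity
  unfold epsCplx tauCplx
  rw [rescale_mul_inv, mul_inv_cancel₀ hne, pow_zero, mul_inv_cancel₀ one_ne_zero, one_mul]
  exact ⟨rfl, rfl⟩

omit i in
/-- `ϑ ≤ 1∕2` under the displayed (145) numerics `ε ≤ 1∕16`, `(d+1)(ε + τ) ≤ 1∕16`. [cite: Balaban1985Averaging, (145)–(147) p.40, bookkeeping] -/
theorem thetaCplx_le_half {α₀' ϱ' : ℝ} (hα : 0 ≤ α₀') (hϱ : 0 ≤ ϱ')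
    (hdX : ((d + 1 : ℕ) : ℝ) * (epsCplx (d + 1) (ℓ + 1) ϱ' 0 + tauCplx (d + 1) (ℓ + 1) α₀' 0 ϱ' 0) ≤ 1 / 16) :
    thetaCplx (d + 1) (ℓ + 1) α₀' 0 ϱ' ≤ 1 / 2 := by
  have he := B7Prop5CplxLevels.epsCplx_nonneg (d + 1) (ℓ + 1) hϱ 0
  have ht := B7Prop5CplxLevels.tauCplx_nonneg (d + 1) (ℓ + 1) hα 0 hϱ 0
  have hd1 : (1 : ℝ) ≤ ((d + 1 : ℕ) : ℝ) := by exact_mod_cast Nat.succ_le_succ (Nat.zero_le d)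
  have hsum : epsCplx (d + 1) (ℓ + 1) ϱ' 0 + tauCplx (d + 1) (ℓ + 1) α₀' 0 ϱ' 0 ≤ 1 / 16 := by nlinarith
  unfold thetaCplx; linarith

/-- **A BOX BOND's SOURCE LIES IN AN END BLOCK OF `ι`**: for `(x, μ)` a bond of the double box of `ι` (level `j`), the `j`-block of the torus site under `x` is `ι₋` or `ι₊`
([5] p. 24 locality window; the shape of this lineage's `iterBlockOf_of_boxK_ne_zero`). [cite: Balaban1985Averaging, p.24; Balaban1984PropagatorsII, (2.3) p.224] -/
theorem end_block_of_mem_bondsIn (ι : IBondY i) {s : LSite (d + 1) × Fin (d + 1)}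
    (hs : s ∈ bondsIn (loK (ℓ + 1) (ι.1.1 : ℕ) (zSrc i ι)) (bondHiK (ℓ + 1) (ι.1.1 : ℕ) (zSrc i ι) ι.1.2.dir)) :
    iterBlockOf (ι.1.1 : ℕ) (transl (0 : Site (PV d ℓ i.m i.K hd hL) 0) s.1) = ι.1.2.src ∨
      iterBlockOf (ι.1.1 : ℕ) (transl (0 : Site (PV d ℓ i.m i.K hd hL) 0) s.1) = ι.1.2.tgt := by
  have hj : (ι.1.1 : ℕ) ≤ i.m + i.K := (lvl_le' i ι).trans i.hk
  have hx := (mem_bondsIn.1 hs).1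
  rw [iterBlockOf_transl_zero i hj]
  rcases blk_of_inBox_bond hx with hb | hb
  · left; rw [hb, transl_zero_zSrc]
  · right; rw [hb, transl_add_e, transl_zero_zSrc]; rfl

end Dict

/-! ## §2 `(Q(e^{iηa}U)Λ)(ι)` through the retraction, ungated, at the complex background `e^{a♭}·Û_ι` -/

section Main

open scoped Matrix Matrix.Norms.L2Operator

variable {N : ℕ} [Nonempty (Fin N)] (i : KIdx d ℓ hd hL b₀ b₁) {G : Subgroup (Matrix (Fin N) (Fin N) ℂ)ˣ}
  (hG1 : ∀ u : (Matrix (Fin N) (Fin N) ℂ)ˣ, u ∈ G → ‖(u : Matrix (Fin N) (Fin N) ℂ)‖ ≤ 1)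
  (hGU : G ≤ unitaryUnits (Matrix (Fin N) (Fin N) ℂ))
  {U : CfgY (Matrix (Fin N) (Fin N) ℂ) i} {c₀ α₀ : ℝ} (hc : c₀ ≤ 10) (hMα : 0 ≤ (kGeo i).M * α₀)
  (hreg : (bg9KP (Matrix (Fin N) (Fin N) ℂ) G i).Reg335 c₀ α₀ U)
  -- the x-free numerics of the (3.35) ⟹ (52) bridge at the retraction
  {α₀' : ℝ} (hα' : 0 < α₀') (hα3 : C0 (d + 1) * α₀' ≤ 1 / 3) (hα8 : 8 * α₀' ≤ c2' (d + 1) (ℓ + 1))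
  (hK : Kpl i ((kGeo i).M * α₀) * (kGeo i).L ^ 4 < α₀')
  -- r04∕p06's Prop-7∕Prop-5 window at the radii `ϱ′` (background) and `ϱ` (field), in COARSE units (`Lʲρ′ = ϱ′`)
  {ϱ' ϱ : ℝ} (hϱ' : 0 < ϱ') (hϱ : 0 < ϱ)
  (hsmall' : Real.exp (4 * (800 * (((d + 1 : ℕ) : ℝ) + 1) ^ 2 * (((d + 1 : ℕ) : ℝ) + 4)) * α₀')
    * (1 + 8 * (131072 * (((d + 1 : ℕ) : ℝ) + 1) ^ 2) * ϱ') ≤ 2)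
  (hc₃' : 2 * ϱ' ≤ c3 (d + 1) (ℓ + 1)) (hϱ'1 : 409600 * (((d + 1 : ℕ) : ℝ) + 1) ^ 2 * ϱ' ≤ 1)
  (hE : epsCplx (d + 1) (ℓ + 1) ϱ' 0 ≤ 1 / 16)
  (hdX : ((d + 1 : ℕ) : ℝ) * (epsCplx (d + 1) (ℓ + 1) ϱ' 0 + tauCplx (d + 1) (ℓ + 1) α₀' 0 ϱ' 0) ≤ 1 / 16)
  (hsmall : Real.exp (4480 * (((d + 1 : ℕ) : ℝ) + 1) ^ 2 * (((d + 1 : ℕ) : ℝ) + 4) * α₀' + 240000 * (((d + 1 : ℕ) : ℝ) + 1) ^ 3 * ϱ')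
    * (1 + 8 * (2097152 * (((d + 1 : ℕ) : ℝ) + 1) ^ 2) * ϱ) ≤ 2)
  (hc₃ : 2 * ϱ ≤ c3 (d + 1) (ℓ + 1) / 4)
  -- the perturbation: print's (3.37) smallness on the two end blocks of `ι`
  (a : Fin (d + 1) → Site (PV d ℓ i.m i.K hd hL) 0 → Matrix (Fin N) (Fin N) ℂ) {α₁ : ℝ} (hα₁ : 0 ≤ α₁) (hα₁ϱ : 3 * α₁ ≤ ϱ') (ι : IBondY i)
  (ha : ∀ (μ : Fin (d + 1)) (x : Site (PV d ℓ i.m i.K hd hL) 0),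
    iterBlockOf (ι.1.1 : ℕ) x = ι.1.2.src ∨ iterBlockOf (ι.1.1 : ℕ) x = ι.1.2.tgt →
      (((ℓ + 1 : ℕ) : ℝ)) ^ (ι.1.1 : ℕ) * (kGeo i).eta * ‖a μ x‖ ≤ α₁)

omit [Nonempty (Fin N)] in
include hα₁ ha in
/-- the lifted exponent `a♯(s) = iη·a(s♭)` and its box restriction `a♭` are bounded by `α₁·L^{−j}` on the box of `ι`, `a♭` everywhere.
[cite: Balaban1985BackgroundPropagators, (3.37) p.396, (3.81) p.406, bookkeeping] -/
theorem norm_boxExponent_le :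
    ∀ (x : LSite (d + 1)) (κ : Fin (d + 1)),
      ‖insCfg (bondsIn (loK (ℓ + 1) (ι.1.1 : ℕ) (zSrc i ι)) (bondHiK (ℓ + 1) (ι.1.1 : ℕ) (zSrc i ι) ι.1.2.dir))
          (restr (bondsIn (loK (ℓ + 1) (ι.1.1 : ℕ) (zSrc i ι)) (bondHiK (ℓ + 1) (ι.1.1 : ℕ) (zSrc i ι) ι.1.2.dir))
            (fun z μ => ((Complex.I * ((kGeo i).eta : ℝ) : ℂ)) • a μ (transl (0 : Site (PV d ℓ i.m i.K hd hL) 0) z))) x κ‖ ≤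
        α₁ * ((((ℓ + 1 : ℕ) : ℝ)) ^ (ι.1.1 : ℕ))⁻¹ := by
  classical
  intro x κ
  have hLj : (0 : ℝ) < (((ℓ + 1 : ℕ) : ℝ)) ^ (ι.1.1 : ℕ) := by positivity
  have hη : 0 ≤ (kGeo i).eta := by show 0 ≤ |i.cf|⁻¹; positivity
  by_cases hmem : (x, κ) ∈ bondsIn (loK (ℓ + 1) (ι.1.1 : ℕ) (zSrc i ι)) (bondHiK (ℓ + 1) (ι.1.1 : ℕ) (zSrc i ι) ι.1.2.dir)
  · have hval : insCfg (bondsIn (loK (ℓ + 1) (ι.1.1 : ℕ) (zSrc i ι)) (bondHiK (ℓ + 1) (ι.1.1 : ℕ) (zSrc i ι) ι.1.2.dir))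
          (restr (bondsIn (loK (ℓ + 1) (ι.1.1 : ℕ) (zSrc i ι)) (bondHiK (ℓ + 1) (ι.1.1 : ℕ) (zSrc i ι) ι.1.2.dir))
            (fun z μ => ((Complex.I * ((kGeo i).eta : ℝ) : ℂ)) • a μ (transl (0 : Site (PV d ℓ i.m i.K hd hL) 0) z))) x κ =
        ((Complex.I * ((kGeo i).eta : ℝ) : ℂ)) • a κ (transl (0 : Site (PV d ℓ i.m i.K hd hL) 0) x) := by
      simp [insCfg, restr, hmem]
    rw [hval, norm_smul, norm_mul, Complex.norm_I, one_mul, Complex.norm_real, Real.norm_of_nonneg hη]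
    have hb := ha κ (transl (0 : Site (PV d ℓ i.m i.K hd hL) 0) x) (end_block_of_mem_bondsIn i ι hmem)
    rw [le_mul_inv_iff₀ hLj]
    calc (kGeo i).eta * ‖a κ (transl 0 x)‖ * (((ℓ + 1 : ℕ) : ℝ)) ^ (ι.1.1 : ℕ)
        = (((ℓ + 1 : ℕ) : ℝ)) ^ (ι.1.1 : ℕ) * (kGeo i).eta * ‖a κ (transl 0 x)‖ := by ring
      _ ≤ α₁ := hb
  · have hval : insCfg (bondsIn (loK (ℓ + 1) (ι.1.1 : ℕ) (zSrc i ι)) (bondHiK (ℓ + 1) (ι.1.1 : ℕ) (zSrc i ι) ι.1.2.dir))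
          (restr (bondsIn (loK (ℓ + 1) (ι.1.1 : ℕ) (zSrc i ι)) (bondHiK (ℓ + 1) (ι.1.1 : ℕ) (zSrc i ι) ι.1.2.dir))
            (fun z μ => ((Complex.I * ((kGeo i).eta : ℝ) : ℂ)) • a μ (transl (0 : Site (PV d ℓ i.m i.K hd hL) 0) z))) x κ = 0 := by
      simp [insCfg, hmem]
    rw [hval, norm_zero]; positivity

include hG1 hGU hc hMα hreg hα' hα3 hα8 hK hα₁ ha in
/-- ★★ **`(Q(e^{iηa}U)Λ)(ι)` THROUGH THE RETRACTION, UNGATED**: `(Q(e^{iηa}U)Λ)(ι) = L^{−j}·(LʲQ_j(e^{a♭}·Û_ι)Λ♯)(z_ι, κ)` where `a♭` is the restriction of `a♯ = iη·a(·♭)` to the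
bonds of the double box — locality of the gated composite in the pair (background, field) (`linCovIterC_congr`; the lift of the product is `e^{a♯}U♯`, `liftCfg_mulY_fluct`), and
the gate is open at every level `< j` of the complex background `e^{a♭}Û_ι` (r04's `level_loops_lt_one`: the retraction is `U(N)`-valued and `α₀′L^{−2j}`-regular on
(3.35) by `pdev_retract_bond_lt`, the exponent is `α₁L^{−j}`-small). [cite: Balaban1985BackgroundPropagators, (3.78) p.406, (3.12)–(3.15) p.393, (3.35) p.396; Balaban1985Averaging, Proposition 7 p.43, p.24] -/
theorem QknitY_mulY_apply_retract
    (hsmall'ι : Real.exp (4 * (800 * (((d + 1 : ℕ) : ℝ) + 1) ^ 2 * (((d + 1 : ℕ) : ℝ) + 4)) * α₀')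
      * (1 + 8 * (131072 * (((d + 1 : ℕ) : ℝ) + 1) ^ 2) * ((((ℓ + 1 : ℕ) : ℝ)) ^ (ι.1.1 : ℕ) * (α₁ * ((((ℓ + 1 : ℕ) : ℝ)) ^ (ι.1.1 : ℕ))⁻¹))) ≤ 2)
    (hc₃'ι : 2 * ((((ℓ + 1 : ℕ) : ℝ)) ^ (ι.1.1 : ℕ) * (α₁ * ((((ℓ + 1 : ℕ) : ℝ)) ^ (ι.1.1 : ℕ))⁻¹)) ≤ c3 (d + 1) (ℓ + 1))
    (hb'1ι : 409600 * (((d + 1 : ℕ) : ℝ) + 1) ^ 2 * ((((ℓ + 1 : ℕ) : ℝ)) ^ (ι.1.1 : ℕ) * (α₁ * ((((ℓ + 1 : ℕ) : ℝ)) ^ (ι.1.1 : ℕ))⁻¹)) ≤ 1)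
    (Λ : FBondY i → Matrix (Fin N) (Fin N) ℂ) :
    QknitY i (fun μ x => fluct (kGeo i).eta a μ x * U μ x) Λ ι =
      (((((ℓ + 1 : ℕ) : ℝ) ^ (ι.1.1 : ℕ))⁻¹ : ℝ) : ℂ) •
        linCovIter (ℓ + 1)
          (expCfg (insCfg (bondsIn (loK (ℓ + 1) (ι.1.1 : ℕ) (zSrc i ι)) (bondHiK (ℓ + 1) (ι.1.1 : ℕ) (zSrc i ι) ι.1.2.dir))
              (restr (bondsIn (loK (ℓ + 1) (ι.1.1 : ℕ) (zSrc i ι)) (bondHiK (ℓ + 1) (ι.1.1 : ℕ) (zSrc i ι) ι.1.2.dir))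
                (fun z μ => ((Complex.I * ((kGeo i).eta : ℝ) : ℂ)) • a μ (transl (0 : Site (PV d ℓ i.m i.K hd hL) 0) z)))) * retrY i U ι)
          (liftBd i Λ) (ι.1.1 : ℕ) (zSrc i ι) ι.1.2.dir := by
  classical
  letI : CStarAlgebra (Matrix (Fin N) (Fin N) ℂ) := {}
  have hL1 : 1 ≤ ℓ + 1 := Nat.succ_pos ℓ
  have hL2 : 2 ≤ ℓ + 1 := hL.2
  set S := bondsIn (loK (ℓ + 1) (ι.1.1 : ℕ) (zSrc i ι)) (bondHiK (ℓ + 1) (ι.1.1 : ℕ) (zSrc i ι) ι.1.2.dir) with hS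
  set Ash : LSite (d + 1) → Fin (d + 1) → Matrix (Fin N) (Fin N) ℂ :=
    fun z μ => ((Complex.I * ((kGeo i).eta : ℝ) : ℂ)) • a μ (transl (0 : Site (PV d ℓ i.m i.K hd hL) 0) z) with hAsh
  set Afl := insCfg S (restr S Ash) with hAfl
  have hU : ∀ μ x, U μ x ∈ unitaryUnits (Matrix (Fin N) (Fin N) ℂ) := fun μ x => hGU (mem_of_reg335P (G := G) i hreg μ x)
  have hVu : ∀ x μ, retrY i U ι x μ ∈ unitaryUnits (Matrix (Fin N) (Fin N) ℂ) := retrY_mem i hU ι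
  have h52 : pdev (retrY i U ι) < α₀' * ((((ℓ + 1 : ℕ) : ℝ) ^ (ι.1.1 : ℕ))⁻¹) ^ 2 := pdev_retract_bond_lt i hG1 U hc hMα hreg hK ι
  -- locality: `(e^{iηa}U)♯ = e^{a♯}U♯` agrees with `e^{a♭}Û_ι` on the box bonds
  have hag : AgreeOn (loK (ℓ + 1) (ι.1.1 : ℕ) (zSrc i ι)) (bondHiK (ℓ + 1) (ι.1.1 : ℕ) (zSrc i ι) ι.1.2.dir)
      (liftCfg (P := PV d ℓ i.m i.K hd hL) (fun μ x => fluct (kGeo i).eta a μ x * U μ x)) (expCfg Afl * retrY i U ι) := by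
    rw [liftCfg_mulY_fluct]
    intro x κ hx hxe
    rw [Pi.mul_apply, Pi.mul_apply, Pi.mul_apply, Pi.mul_apply, agreeOn_expCfg (agreeOn_insCfg_restr _ _ Ash) x κ hx hxe,
      agreeOn_liftCfg_retrY i U ι x κ hx hxe]
  -- the gate is open at every level `< j` of the complex background
  have hβ : (0 : ℝ) ≤ α₁ * ((((ℓ + 1 : ℕ) : ℝ)) ^ (ι.1.1 : ℕ))⁻¹ := by positivity
  have hAfl : ∀ x κ, ‖Afl x κ‖ ≤ α₁ * ((((ℓ + 1 : ℕ) : ℝ)) ^ (ι.1.1 : ℕ))⁻¹ := norm_boxExponent_le i a hα₁ ι ha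
  have hW : ∀ n < (ι.1.1 : ℕ), ∀ (z : LSite (d + 1)) (κ : Fin (d + 1)) (r : Fin (d + 1) → Fin (ℓ + 1)),
      ‖((Wcx (ℓ + 1) (avgIter (ℓ + 1) (expCfg Afl * retrY i U ι) n) (((ℓ + 1 : ℕ) : ℤ) • z) κ (boxVec (ℓ + 1) r) :
        (Matrix (Fin N) (Fin N) ℂ)ˣ) : Matrix (Fin N) (Fin N) ℂ) - 1‖ < 1 := by
    intro n hn z κ r
    rw [avgIter_cplx_eq]
    exact level_loops_lt_one (ℓ + 1) hL2 (avgClosed_unitaryUnits (d + 1) (ℓ + 1)) (ι.1.1 : ℕ) (retrY i U ι) hVu hα' hα3 hα8 h52 Afl hβ hAfl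
      hsmall'ι hc₃'ι hb'1ι hn _ κ r
  have hung := linCovIterC_eq_linCovIter (ℓ + 1) (expCfg Afl * retrY i U ι) (liftBd i Λ) (ι.1.1 : ℕ) hW
  rw [QknitY_apply, linCovIterC_congr (ℓ + 1) hL1 (ι.1.1 : ℕ) (zSrc i ι) ι.1.2.dir hag (fun _ _ _ _ => rfl), hung]

/-! ## §3 (3.80)–(3.81) for the knit letter, row form -/

include hG1 hGU hc hMα hreg hα' hα3 hα8 hK hϱ' hϱ hsmall' hc₃' hϱ'1 hE hdX hsmall hc₃ hα₁ hα₁ϱ ha in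
/-- ★★★ **[B9] (3.80)–(3.81) FOR THE KNIT AVERAGING LETTER ON (3.35), ROW FORM**: at an index bond `ι` of level `j`,
`‖(Q(e^{iηa}·U)Λ)(ι) − (Q(U)Λ)(ι)‖ ≤ (9∕(2ϱ′))·α₁·Σ_f boxK ι f·‖Λ(f)‖` for every bond function `Λ`, every member background `U` of `(bg9KP … G i).Reg335 c₀ α₀`
(`G ≤ U(N)` unit-bounded, `c₀ ≤ 10`, `0 ≤ Mα₀`), every complex `a` with `Lʲη·‖a_μ(x)‖ ≤ α₁` on the two end blocks of `ι` and `3α₁ ≤ ϱ′`, under the x-free numerics of the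
section — print's `F_{2,j}(A) = Q_j(U′U) − Q_j(U)`, `|F_{2,j}(A)A′| ≦ O(1)α₁Q″_j|A′|`, with `Q″_j` the tree's box kernel `boxK` and `O(1) = 9∕(2ϱ′)`.  Steps: §2 and
`QknitY_apply_retract` put both letters at the base `Û_ι` through the ungated composites; file 1's `norm_linCovIter_sub_base_le_sum` (scale `k := j`, radii
`ϱ′L^{−j}`, `ϱL^{−j}`, perturbation `a♭` of size `α₁L^{−j}`) bounds the difference; `sum_boxK_mul_eq` reads the box mass of `Λ♯` fibrewise; `1 + ϑ ≤ 3∕2`.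
[cite: Balaban1985BackgroundPropagators, (3.80)–(3.81) p.406, (3.35) p.396, (3.37) p.396; Balaban1985Averaging, Proposition 7 p.43, (146)–(147) p.40, (141) p.39] -/
theorem norm_QknitY_mulY_sub_apply_le (Λ : FBondY i → Matrix (Fin N) (Fin N) ℂ) :
    ‖QknitY i (fun μ x => fluct (kGeo i).eta a μ x * U μ x) Λ ι - QknitY i U Λ ι‖ ≤ 9 / (2 * ϱ') * α₁ * ∑ f, boxK i ι f * ‖Λ f‖ := by
  classical
  letI : CStarAlgebra (Matrix (Fin N) (Fin N) ℂ) := {}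
  have hL2 : 2 ≤ ℓ + 1 := hL.2
  have hα2 : 2 * α₀' ≤ c2' (d + 1) (ℓ + 1) := by linarith
  set j : ℕ := (ι.1.1 : ℕ) with hjdef
  set Lj : ℝ := (((ℓ + 1 : ℕ) : ℝ)) ^ j with hLj
  have hLj0 : 0 < Lj := by positivity
  set S := bondsIn (loK (ℓ + 1) j (zSrc i ι)) (bondHiK (ℓ + 1) j (zSrc i ι) ι.1.2.dir) with hS
  set Ash : LSite (d + 1) → Fin (d + 1) → Matrix (Fin N) (Fin N) ℂ :=
    fun z μ => ((Complex.I * ((kGeo i).eta : ℝ) : ℂ)) • a μ (transl (0 : Site (PV d ℓ i.m i.K hd hL) 0) z) with hAsh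
  set Afl := insCfg S (restr S Ash) with hAfl
  set B := liftBd i Λ with hB
  have hU : ∀ μ x, U μ x ∈ unitaryUnits (Matrix (Fin N) (Fin N) ℂ) := fun μ x => hGU (mem_of_reg335P (G := G) i hreg μ x)
  have hVu : ∀ x μ, retrY i U ι x μ ∈ unitaryUnits (Matrix (Fin N) (Fin N) ℂ) := retrY_mem i hU ι
  have h52 : pdev (retrY i U ι) < α₀' * ((Lj)⁻¹) ^ 2 := pdev_retract_bond_lt i hG1 U hc hMα hreg hK ι
  -- the radii in lattice units at scale `j`
  set ρ' : ℝ := ϱ' * Lj⁻¹ with hρ'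
  set ρ : ℝ := ϱ * Lj⁻¹ with hρdef
  have hρ'0 : 0 < ρ' := by positivity
  have hρ0 : 0 < ρ := by positivity
  have eρ' : Lj * ρ' = ϱ' := rescale_mul_inv j ϱ'
  have eρ : Lj * ρ = ϱ := rescale_mul_inv j ϱ
  have hsmall'F : Real.exp (4 * (800 * (((d + 1 : ℕ) : ℝ) + 1) ^ 2 * (((d + 1 : ℕ) : ℝ) + 4)) * α₀')
      * (1 + 8 * (131072 * (((d + 1 : ℕ) : ℝ) + 1) ^ 2) * (Lj * ρ')) ≤ 2 := by rw [eρ']; exact hsmall'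
  have hc₃'F : 2 * (Lj * ρ') ≤ c3 (d + 1) (ℓ + 1) := by rw [eρ']; exact hc₃'
  have hρ'1F : 409600 * (((d + 1 : ℕ) : ℝ) + 1) ^ 2 * (Lj * ρ') ≤ 1 := by rw [eρ']; exact hϱ'1
  obtain ⟨eE, eT⟩ := epsCplx_tauCplx_rescale (d := d) (ℓ := ℓ) α₀' ϱ' j
  have hEF : epsCplx (d + 1) (ℓ + 1) ρ' j ≤ 1 / 16 := by rw [hρ', eE]; exact hE
  have hdXF : ((d + 1 : ℕ) : ℝ) * (epsCplx (d + 1) (ℓ + 1) ρ' j + tauCplx (d + 1) (ℓ + 1) α₀' j ρ' j) ≤ 1 / 16 := by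
    rw [hρ', eE, eT]; exact hdX
  have hsmallF : Real.exp (4480 * (((d + 1 : ℕ) : ℝ) + 1) ^ 2 * (((d + 1 : ℕ) : ℝ) + 4) * α₀' + 240000 * (((d + 1 : ℕ) : ℝ) + 1) ^ 3 * (Lj * ρ'))
      * (1 + 8 * (2097152 * (((d + 1 : ℕ) : ℝ) + 1) ^ 2) * (Lj * ρ)) ≤ 2 := by rw [eρ', eρ]; exact hsmall
  have hc₃F : 2 * (Lj * ρ) ≤ c3 (d + 1) (ℓ + 1) / 4 := by rw [eρ]; exact hc₃
  -- the perturbation `a♭` has size `β = α₁L^{−j}`, `3β ≤ ρ′`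
  set β : ℝ := α₁ * Lj⁻¹ with hβdef
  have hβ0 : 0 ≤ β := by positivity
  have hβρ : 3 * β ≤ ρ' := by
    rw [hβdef, hρ']
    have := mul_le_mul_of_nonneg_right hα₁ϱ (inv_pos.2 hLj0).le
    linarith
  have hβρ' : β ≤ ρ' := by linarith
  have hAfl : ∀ x κ, ‖Afl x κ‖ ≤ β := norm_boxExponent_le i a hα₁ ι ha
  obtain ⟨hsβ, hcβ, h1β, -, -⟩ := smallness7_mono (d := d + 1) (L := ℓ + 1) (k := j) (α₀ := α₀') hβρ' le_rfl hρ0.le hsmall'F hc₃'F hρ'1F hsmallF hc₃F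
  -- both letters through the retraction
  have e1 := QknitY_mulY_apply_retract i hG1 hGU hc hMα hreg hα' hα3 hα8 hK a hα₁ ι ha hsβ hcβ h1β Λ
  have e0 := QknitY_apply_retract i hG1 hGU U hc hMα hreg hα' hα3 hα2 hK Λ ι
  -- file 1 at the base `Û_ι`
  have hrow := norm_linCovIter_sub_base_le_sum (ℓ + 1) hL2 (avgClosed_unitaryUnits (d + 1) (ℓ + 1)) j (retrY i U ι) hVu hα' hα3 hα8 h52 hρ'0 hρ0
    hsmall'F hc₃'F hρ'1F hEF hdXF hsmallF hc₃F Afl hβ0 hAfl hβρ B le_rfl (zSrc i ι) ι.1.2.dir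
  -- the coefficient: `ϑ` is level-free and `≤ 1/2`
  have hθ : thetaCplx (d + 1) (ℓ + 1) α₀' j ρ' * (Lj * Lj⁻¹) ≤ 1 / 2 := by
    rw [mul_inv_cancel₀ hLj0.ne', mul_one, hρ', thetaCplx_rescale]
    exact thetaCplx_le_half (d := d) (ℓ := ℓ) hα'.le hϱ'.le hdX
  have hθ0 : 0 ≤ thetaCplx (d + 1) (ℓ + 1) α₀' j ρ' * (Lj * Lj⁻¹) := mul_nonneg (thetaCplx_nonneg (d + 1) (ℓ + 1) hα'.le j hρ'0.le) (by positivity)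
  -- the box mass of `Λ♯`, fibrewise
  have hmass : ∑ s ∈ S, ‖B s.1 s.2‖ = Lj ^ (d + 1) * ∑ f, boxK i ι f * ‖Λ f‖ := by
    have h := sum_boxK_mul_eq i ι fun f => ‖Λ f‖
    rw [h, ← mul_assoc, mul_inv_cancel₀ (by positivity), one_mul, hB]
    exact Finset.sum_congr rfl fun s _ => by rw [liftBd_apply]
  have hsum0 : 0 ≤ ∑ f, boxK i ι f * ‖Λ f‖ := Finset.sum_nonneg fun f _ => mul_nonneg (boxK_nonneg i ι f) (norm_nonneg _)
  -- assemble
  rw [e1, e0, ← smul_sub, norm_smul, Complex.norm_real, Real.norm_of_nonneg (by positivity)]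
  rw [hmass] at hrow
  have hdiff := hrow
  calc Lj⁻¹ * ‖linCovIter (ℓ + 1) (expCfg Afl * retrY i U ι) B j (zSrc i ι) ι.1.2.dir - linCovIter (ℓ + 1) (retrY i U ι) B j (zSrc i ι) ι.1.2.dir‖
      ≤ Lj⁻¹ * (3 / ρ' * β * ((1 + thetaCplx (d + 1) (ℓ + 1) α₀' j ρ' * (Lj * Lj⁻¹)) * (Lj * ((Lj ^ (d + 1))⁻¹))) *
          (Lj ^ (d + 1) * ∑ f, boxK i ι f * ‖Λ f‖)) := mul_le_mul_of_nonneg_left hdiff (by positivity)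
    _ ≤ Lj⁻¹ * (3 / ρ' * β * ((1 + 1 / 2) * (Lj * ((Lj ^ (d + 1))⁻¹))) * (Lj ^ (d + 1) * ∑ f, boxK i ι f * ‖Λ f‖)) := by
        have h32 : (1 + thetaCplx (d + 1) (ℓ + 1) α₀' j ρ' * (Lj * Lj⁻¹)) * (Lj * ((Lj ^ (d + 1))⁻¹)) ≤ (1 + 1 / 2) * (Lj * ((Lj ^ (d + 1))⁻¹)) :=
          mul_le_mul_of_nonneg_right (by linarith) (by positivity)
        have hc0 : 0 ≤ 3 / ρ' * β := by positivity
        gcongr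
    _ = 9 / (2 * ϱ') * α₁ * ∑ f, boxK i ι f * ‖Λ f‖ := by
        rw [hρ', hβdef]
        have hP : Lj ^ (d + 1) ≠ 0 := by positivity
        field_simp
        ring

end Main

end Literature.MathematicalPhysics.QuantumFieldTheory.Balaban1983to89.B9Eq380QknitVariationY

end
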